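import Summits.CriticalPhenomena.SAWScalingLimit.Theorems.SAWDefectDecoherenceBoundaryClosureRZigzagDiscretisationCorner
import Summits.CriticalPhenomena.SAWScalingLimit.Theorems.SAWDefectDecoherenceBoundaryClosureRZigzagDiscretisationWalks
import HarnessLib

/-!
# Crux `BoundaryClosureR` (stmt-CriticalPhenomena-14004), line `polygon-parity-squeeze`,
# stub `stub_innerPolygonsOfZigzag` (7b): exits from the boundary layer near a flat chart

Landing target:
`Summits/CriticalPhenomena/SAWScalingLimit/Theorems/SAWDefectDecoherenceBoundaryClosureRZigzagDiscretisationExitSide.lean`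
(`--supports stmt-CriticalPhenomena-14004`; building block of the registered stub
`stub_innerPolygonsOfZigzag`, the lattice half of the inner-polygon construction (IP)).

Connectivity of the trimmed discretisation `Λ^P_δ` (and of its complement) is reduced to the thick
interior (exterior) of `P` by WALKING along the normal-direction lattice walks `zdWalk`:

* `exists_walk_scale`, `dist_walk_le`, `walk_end` — a walk of `4q` steps with `L ≤ q√3δ ≤ L + 2δ`
  stays within `q√3δ + 3δ` of its start and ends exactly at `start + q√3δ·n_j`;
* `eventually_exit_up_side` — a kept face with scaled centre within `r/8` of an `r`-far frontier
  point walks INWARD through kept faces (the chart's form never decreases) to a face at distance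
  `≥ r/8` from `Pᶜ`;
* `eventually_exit_down_side` — a non-kept face there walks OUTWARD through non-kept faces to a face
  at distance `≥ r/8` from `closure P` (and within `r` of the start).

Sources: folklore.  No proposition is defined and no named fact is introduced.
-/

noncomputable section

open scoped ComplexConjugate Topology
open Set Metric Filter
open Literature.Probability.LatticeModels Literature.Probability.RandomPlanarGeometry
  Literature.Probability.RandomPlanarGeometry.SAW
open Summit.CriticalPhenomena.SAWScalingLimit.Theorems.PolygonParitySqueeze.InnerZigzag
  (level_split level_add_smul halfPlane_eq_of_level_eq_zero)

namespace Summit.CriticalPhenomena.SAWScalingLimit.Theorems.PolygonParitySqueeze.ZigzagDiscretisation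

/-! ### 1. Walk bookkeeping at scale `δ` -/

/-- **Choice of the number of periods**: for `L ≥ 0` and `δ > 0` there is `q : ℕ` with
`L ≤ q√3δ ≤ L + 2δ`. [folklore] -/
theorem exists_walk_scale {L δ : ℝ} (hL : 0 ≤ L) (hδ : 0 < δ) :
    ∃ q : ℕ, L ≤ q * Real.sqrt 3 * δ ∧ q * Real.sqrt 3 * δ ≤ L + 2 * δ := by
  have h3p : 0 < Real.sqrt 3 := Real.sqrt_pos.2 (by norm_num)
  have h32 : Real.sqrt 3 < 2 := by
    rw [show (2 : ℝ) = Real.sqrt 4 by rw [show (4 : ℝ) = 2 ^ 2 by norm_num, Real.sqrt_sq (by norm_num)]]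
    exact Real.sqrt_lt_sqrt (by norm_num) (by norm_num)
  have hpos : 0 < Real.sqrt 3 * δ := by positivity
  refine ⟨⌈L / (Real.sqrt 3 * δ)⌉₊, ?_, ?_⟩
  · have := Nat.le_ceil (L / (Real.sqrt 3 * δ))
    rw [div_le_iff₀ hpos] at this
    linarith
  · have := Nat.ceil_lt_add_one (div_nonneg hL hpos.le)
    have h2 : (⌈L / (Real.sqrt 3 * δ)⌉₊ : ℝ) * (Real.sqrt 3 * δ) < (L / (Real.sqrt 3 * δ) + 1) * (Real.sqrt 3 * δ) :=
      mul_lt_mul_of_pos_right this hpos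
    rw [add_mul, div_mul_cancel₀ _ hpos.ne', one_mul] at h2
    nlinarith

/-- **The walk stays near its start**: within `4q` steps the scaled centre is within `q√3δ + 3δ`.
[folklore] -/
theorem dist_walk_le (j : Fin 6) (v : HexVertex) {δ : ℝ} (hδ : 0 < δ) {q i : ℕ} (hi : i ≤ 4 * q) :
    dist ((δ : ℂ) * hexCenter (zdWalk j v i)) ((δ : ℂ) * hexCenter v) ≤ q * Real.sqrt 3 * δ + 3 * δ := by
  obtain ⟨e, he, hen⟩ := hexCenter_zdWalk j v i
  have h3p : 0 ≤ Real.sqrt 3 := Real.sqrt_nonneg 3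
  have e1 : hexCenter v + ((i / 4 : ℕ) : ℂ) * (Real.sqrt 3 : ℂ) * innerNormal j + e - hexCenter v =
      ((i / 4 : ℕ) : ℂ) * (Real.sqrt 3 : ℂ) * innerNormal j + e := by ring
  rw [dist_eq_norm, ← mul_sub, he, e1, norm_mul, Complex.norm_real, Real.norm_of_nonneg hδ.le]
  have hq : ((i / 4 : ℕ) : ℝ) ≤ q := by exact_mod_cast (Nat.div_le_of_le_mul (by omega))
  have h1 : ‖((i / 4 : ℕ) : ℂ) * (Real.sqrt 3 : ℂ) * innerNormal j + e‖ ≤ (i / 4 : ℕ) * Real.sqrt 3 + 3 := by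
    refine (norm_add_le _ _).trans ?_
    rw [norm_mul, norm_mul, norm_innerNormal, mul_one, Complex.norm_natCast, Complex.norm_real,
      Real.norm_of_nonneg h3p]
    linarith
  calc δ * ‖((i / 4 : ℕ) : ℂ) * (Real.sqrt 3 : ℂ) * innerNormal j + e‖ ≤ δ * ((i / 4 : ℕ) * Real.sqrt 3 + 3) := by gcongr
    _ ≤ δ * (q * Real.sqrt 3 + 3) := by gcongr
    _ = q * Real.sqrt 3 * δ + 3 * δ := by ring

/-- **The end of the walk**: after `4q` steps the scaled centre is `start + q√3δ·n_j`. [folklore] -/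
theorem walk_end (j : Fin 6) (v : HexVertex) (δ : ℝ) (q : ℕ) :
    (δ : ℂ) * hexCenter (zdWalk j v (4 * q)) = (δ : ℂ) * hexCenter v + ((q * Real.sqrt 3 * δ : ℝ) : ℂ) * innerNormal j := by
  have := hexCenter_zdWalk_add_four_mul j v 0 q
  rw [zero_add, zdWalk_zero] at this
  rw [this]; push_cast; ring

/-! ### 2. Exits near a flat chart -/

section Exits

variable {D : DobrushinDomain} {S : Set ℂ} {Cor : Finset ℂ} {κ : ℂ → Fin 6 × Fin 6 × Bool}
  {r ρ r₁ r₀ : ℝ} {Λ : ℝ → Finset HexVertex} {m m₀ : ℝ → ℤ} {a b : ℝ → Sym2 HexVertex}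

/-- **Up-exit near a flat chart, eventually.** [folklore] -/
theorem eventually_exit_up_side
    (hA : AdmissibleFamily D ρ Λ m b) (hP : PinnedFlatRoot D Λ b (D.pt 0) a r₀ m₀)
    (hSo : IsOpen S) (hSD : S ⊆ D.carrier) (hr : 0 < r) (hrρ : r ≤ ρ / 16) (hrr₁ : r ≤ r₁ / 16) (hr₁r₀ : r₁ ≤ r₀)
    (hD0 : D.carrier ∩ ball (D.pt 0) r₁ = {z : ℂ | (D.pt 0).im < z.im} ∩ ball (D.pt 0) r₁)
    (hF : ∀ w ∈ frontier S, w ∉ ball (D.pt 1) (15 * ρ / 16) → w ∉ ball (D.pt 0) (15 * r₁ / 16) → w ∈ D.carrier)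
    (hdist : ρ + r₁ ≤ dist (D.pt 0) (D.pt 1))
    (hCor : ∀ c ∈ Cor, c ∈ frontier S)
    (hsep : ∀ c ∈ Cor, ∀ c' ∈ Cor, c ≠ c' → 4 * r ≤ dist c c')
    (hflat : ∀ z ∈ frontier S, (∀ c ∈ Cor, r ≤ dist z c) → ∃ k : Fin 6, S ∩ ball z (r / 2) = halfPlane k z ∩ ball z (r / 2))
    (Hκ : ∀ c ∈ Cor, ((κ c).2.2 = true ∧ S ∩ ball c (2 * r) = halfPlane (κ c).1 c ∩ halfPlane (κ c).2.1 c ∩ ball c (2 * r)) ∨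
      ((κ c).2.2 = false ∧ S ∩ ball c (2 * r) = (halfPlane (κ c).1 c ∪ halfPlane (κ c).2.1 c) ∩ ball c (2 * r))) :
    ∀ᶠ δ : ℝ in 𝓝[>] 0, ∀ z ∈ frontier S, (∀ c ∈ Cor, r ≤ dist z c) → ∀ k : Fin 6,
      S ∩ ball z (r / 2) = halfPlane k z ∩ ball z (r / 2) →
      ∀ v ∈ zdLam S Cor κ r (D.pt 1) (D.pt 0) ρ r₁ Λ m m₀ δ, (δ : ℂ) * hexCenter v ∈ ball z (r / 8) →
      ∃ n : ℕ, (∀ i ≤ n, zdWalk k v i ∈ zdLam S Cor κ r (D.pt 1) (D.pt 0) ρ r₁ Λ m m₀ δ) ∧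
        r / 8 ≤ infDist ((δ : ℂ) * hexCenter (zdWalk k v n)) Sᶜ := by
  have hiff := eventually_zdLam_iff_side hA hP hSo hSD hr hrρ hrr₁ hr₁r₀ hD0 hF hdist hCor hsep hflat Hκ
  have hthr := eventually_zdThr_le_zdT hA hP ρ r₁
  have hδ1 : ∀ᶠ δ : ℝ in 𝓝[>] 0, δ ∈ Ioo (0 : ℝ) (r / 200) := Ioo_mem_nhdsGT (by positivity)
  have hSc : Sᶜ.Nonempty := by
    by_contra h
    rw [not_nonempty_iff_eq_empty, compl_empty_iff] at h
    exact D.toJordanDomain.carrier_ne_univ (univ_subset_iff.1 (h ▸ hSD))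
  filter_upwards [hiff, hthr, hδ1] with δ hiffδ hthrδ hδδ z hzF hfar k hk v hv hpz
  obtain ⟨hδ, hδr⟩ := hδδ
  set p : ℂ := (δ : ℂ) * hexCenter v with hp
  have hpz' : dist p z < r / 8 := mem_ball.1 hpz
  obtain ⟨hpS, hT⟩ := (hiffδ z hzF hfar k hk v (mem_ball.2 (by linarith))).1 hv
  have hpH : p ∈ halfPlane k z := by
    have : p ∈ S ∩ ball z (r / 2) := ⟨hpS, mem_ball.2 (by linarith)⟩
    rw [hk] at this; exact this.1
  obtain ⟨q, hq1, hq2⟩ := exists_walk_scale (show (0 : ℝ) ≤ 3 * r / 16 by positivity) hδ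
  refine ⟨4 * q, fun i hi => ?_, ?_⟩
  · -- every face of the walk is kept
    set w := zdWalk k v i with hw
    have hfw : zigzagForm k v ≤ zigzagForm k w := zigzagForm_le_zdWalk k k (half_le_inner_self k) v (Nat.zero_le i)
    have hTw : zdT (D.pt 1) (D.pt 0) ρ r₁ (m δ) (m₀ δ) δ k z ≤ zigzagForm k w := hT.trans hfw
    have hwH : (δ : ℂ) * hexCenter w ∈ halfPlane k z := mem_halfPlane_of_zdThr_le k z hδ w ((hthrδ k z).trans hTw)
    have hwd : dist ((δ : ℂ) * hexCenter w) z < 3 * r / 8 := by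
      calc dist ((δ : ℂ) * hexCenter w) z ≤ dist ((δ : ℂ) * hexCenter w) p + dist p z := dist_triangle _ _ _
        _ ≤ (q * Real.sqrt 3 * δ + 3 * δ) + dist p z := by gcongr; exact dist_walk_le k v hδ hi
        _ < (3 * r / 16 + 2 * δ + 3 * δ) + r / 8 := by linarith
        _ ≤ 3 * r / 8 := by linarith
    have hwS : (δ : ℂ) * hexCenter w ∈ S := by
      have : (δ : ℂ) * hexCenter w ∈ halfPlane k z ∩ ball z (r / 2) := ⟨hwH, mem_ball.2 (by linarith)⟩
      rw [← hk] at this; exact this.1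
    exact (hiffδ z hzF hfar k hk w (mem_ball.2 hwd)).2 ⟨hwS, hTw⟩
  · -- the end of the walk is `r/8`-deep
    rw [walk_end k v δ q, ← hp]
    set p' : ℂ := p + ((q * Real.sqrt 3 * δ : ℝ) : ℂ) * innerNormal k with hp'
    have hlev : 3 * r / 16 ≤ ((p' - z) * conj (innerNormal k)).re := by
      rw [hp', level_add_real_mul_innerNormal_self]
      have := (mem_halfPlane_iff_level k z p).1 hpH
      linarith
    have hp'z : dist p' z ≤ r / 8 + (3 * r / 16 + 2 * δ) := by
      calc dist p' z ≤ dist p' p + dist p z := dist_triangle _ _ _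
        _ ≤ (3 * r / 16 + 2 * δ) + r / 8 := by
          gcongr
          rw [hp', dist_eq_norm, add_sub_cancel_left, norm_mul, norm_innerNormal, mul_one, Complex.norm_real,
            Real.norm_of_nonneg (by positivity)]
          exact hq2
        _ = r / 8 + (3 * r / 16 + 2 * δ) := by ring
    refine le_infDist_compl_of_ball_subset hSc fun y hy => ?_
    have hy1 : y ∈ halfPlane k z := ball_subset_halfPlane_of_level k z p' (r / 8) (by linarith) hy
    have hy2 : y ∈ ball z (r / 2) := by
      rw [mem_ball] at hy ⊢
      calc dist y z ≤ dist y p' + dist p' z := dist_triangle _ _ _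
        _ < r / 8 + (r / 8 + (3 * r / 16 + 2 * δ)) := by linarith
        _ ≤ r / 2 := by linarith
    have : y ∈ halfPlane k z ∩ ball z (r / 2) := ⟨hy1, hy2⟩
    rw [← hk] at this; exact this.1

/-- **Down-exit near a flat chart, eventually.** [folklore] -/
theorem eventually_exit_down_side
    (hA : AdmissibleFamily D ρ Λ m b) (hP : PinnedFlatRoot D Λ b (D.pt 0) a r₀ m₀)
    (hSo : IsOpen S) (hSD : S ⊆ D.carrier) (hSne : S.Nonempty) (hr : 0 < r) (hrρ : r ≤ ρ / 16) (hrr₁ : r ≤ r₁ / 16)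
    (hr₁r₀ : r₁ ≤ r₀)
    (hD0 : D.carrier ∩ ball (D.pt 0) r₁ = {z : ℂ | (D.pt 0).im < z.im} ∩ ball (D.pt 0) r₁)
    (hF : ∀ w ∈ frontier S, w ∉ ball (D.pt 1) (15 * ρ / 16) → w ∉ ball (D.pt 0) (15 * r₁ / 16) → w ∈ D.carrier)
    (hdist : ρ + r₁ ≤ dist (D.pt 0) (D.pt 1))
    (hCor : ∀ c ∈ Cor, c ∈ frontier S)
    (hsep : ∀ c ∈ Cor, ∀ c' ∈ Cor, c ≠ c' → 4 * r ≤ dist c c')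
    (hflat : ∀ z ∈ frontier S, (∀ c ∈ Cor, r ≤ dist z c) → ∃ k : Fin 6, S ∩ ball z (r / 2) = halfPlane k z ∩ ball z (r / 2))
    (Hκ : ∀ c ∈ Cor, ((κ c).2.2 = true ∧ S ∩ ball c (2 * r) = halfPlane (κ c).1 c ∩ halfPlane (κ c).2.1 c ∩ ball c (2 * r)) ∨
      ((κ c).2.2 = false ∧ S ∩ ball c (2 * r) = (halfPlane (κ c).1 c ∪ halfPlane (κ c).2.1 c) ∩ ball c (2 * r))) :
    ∀ᶠ δ : ℝ in 𝓝[>] 0, ∀ z ∈ frontier S, (∀ c ∈ Cor, r ≤ dist z c) → ∀ k : Fin 6,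
      S ∩ ball z (r / 2) = halfPlane k z ∩ ball z (r / 2) →
      ∀ v : HexVertex, v ∉ zdLam S Cor κ r (D.pt 1) (D.pt 0) ρ r₁ Λ m m₀ δ → (δ : ℂ) * hexCenter v ∈ ball z (r / 8) →
      ∃ n : ℕ, (∀ i ≤ n, zdWalk (zdOpp k) v i ∉ zdLam S Cor κ r (D.pt 1) (D.pt 0) ρ r₁ Λ m m₀ δ) ∧
        r / 8 ≤ infDist ((δ : ℂ) * hexCenter (zdWalk (zdOpp k) v n)) (closure S) ∧
        dist ((δ : ℂ) * hexCenter (zdWalk (zdOpp k) v n)) ((δ : ℂ) * hexCenter v) ≤ r := by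
  have hiff := eventually_zdLam_iff_side hA hP hSo hSD hr hrρ hrr₁ hr₁r₀ hD0 hF hdist hCor hsep hflat Hκ
  have hthr := eventually_zdThr_le_zdT hA hP ρ r₁
  have hfloat := eventually_delta_mul_float_le hA hP (show (0 : ℝ) < r / 32 by positivity)
  have hδ1 : ∀ᶠ δ : ℝ in 𝓝[>] 0, δ ∈ Ioo (0 : ℝ) (r / 200) := Ioo_mem_nhdsGT (by positivity)
  filter_upwards [hiff, hthr, hfloat, hδ1] with δ hiffδ hthrδ hflδ hδδ z hzF hfar k hk v hv hpz
  obtain ⟨hδ, hδr⟩ := hδδ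
  set x₁ := D.pt 1
  set x₀ := D.pt 0
  have hU0 : (0 : ℝ) ≤ (|m δ - zdThr 0 x₁ δ| + |m₀ δ - zdThr 0 x₀ δ| + 2 : ℤ) := by
    have h1 := abs_nonneg (m δ - zdThr 0 x₁ δ); have h2 := abs_nonneg (m₀ δ - zdThr 0 x₀ δ)
    have : (0 : ℤ) ≤ |m δ - zdThr 0 x₁ δ| + |m₀ δ - zdThr 0 x₀ δ| + 2 := by linarith
    exact_mod_cast this
  have hmargin := margin_le_of_small hδ (by linarith) hflδ hU0
  set p : ℂ := (δ : ℂ) * hexCenter v with hp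
  have hpz' : dist p z < r / 8 := mem_ball.1 hpz
  -- the test at `z` fails for `v`
  have hfail : ¬ zdT x₁ x₀ ρ r₁ (m δ) (m₀ δ) δ k z ≤ zigzagForm k v := by
    intro hT
    have hpH : p ∈ halfPlane k z := mem_halfPlane_of_zdThr_le k z hδ v ((hthrδ k z).trans hT)
    have hpS : p ∈ S := by
      have : p ∈ halfPlane k z ∩ ball z (r / 2) := ⟨hpH, mem_ball.2 (by linarith)⟩
      rw [← hk] at this; exact this.1
    exact hv ((hiffδ z hzF hfar k hk v (mem_ball.2 (by linarith))).2 ⟨hpS, hT⟩)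
  have hlevp : ((p - z) * conj (innerNormal k)).re ≤ r / 16 := by
    by_contra hcon
    push Not at hcon
    exact hfail (zdT_le_of_lt_level x₁ x₀ ρ r₁ (m δ) (m₀ δ) hδ k z v (by rw [← hp]; linarith))
  obtain ⟨q, hq1, hq2⟩ := exists_walk_scale (show (0 : ℝ) ≤ 3 * r / 16 by positivity) hδ
  refine ⟨4 * q, fun i hi => ?_, ?_, (dist_walk_le _ v hδ le_rfl).trans (by linarith)⟩
  · set w := zdWalk (zdOpp k) v i with hw
    have hfw : zigzagForm k w ≤ zigzagForm k v := by
      have := zigzagForm_le_zdWalk (zdOpp k) (zdOpp k) (half_le_inner_self _) v (Nat.zero_le i)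
      rw [zdWalk_zero, zigzagForm_zdOpp, zigzagForm_zdOpp] at this
      linarith
    have hwd : dist ((δ : ℂ) * hexCenter w) z < 3 * r / 8 := by
      calc dist ((δ : ℂ) * hexCenter w) z ≤ dist ((δ : ℂ) * hexCenter w) p + dist p z := dist_triangle _ _ _
        _ ≤ (q * Real.sqrt 3 * δ + 3 * δ) + dist p z := by gcongr; exact dist_walk_le _ v hδ hi
        _ < (3 * r / 16 + 2 * δ + 3 * δ) + r / 8 := by linarith
        _ ≤ 3 * r / 8 := by linarith
    intro hwin
    have := ((hiffδ z hzF hfar k hk w (mem_ball.2 hwd)).1 hwin).2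
    exact hfail (this.trans hfw)
  · rw [walk_end (zdOpp k) v δ q, ← hp, innerNormal_zdOpp]
    set p' : ℂ := p + ((q * Real.sqrt 3 * δ : ℝ) : ℂ) * -innerNormal k with hp'
    have hp'eq : p' = p + ((-(q * Real.sqrt 3 * δ) : ℝ) : ℂ) * innerNormal k := by rw [hp']; push_cast; ring
    have hlev : ((p' - z) * conj (innerNormal k)).re ≤ r / 16 - 3 * r / 16 := by
      rw [hp'eq, level_add_real_mul_innerNormal_self]; linarith
    have hp'z : dist p' z ≤ r / 8 + (3 * r / 16 + 2 * δ) := by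
      calc dist p' z ≤ dist p' p + dist p z := dist_triangle _ _ _
        _ ≤ (3 * r / 16 + 2 * δ) + r / 8 := by
          gcongr
          rw [hp'eq, dist_eq_norm, add_sub_cancel_left, norm_mul, norm_innerNormal, mul_one, Complex.norm_real,
            Real.norm_eq_abs, abs_neg, abs_of_nonneg (by positivity)]
          exact hq2
        _ = r / 8 + (3 * r / 16 + 2 * δ) := by ring
    refine le_infDist_closure_of_disjoint hSne.closure (disjoint_left.2 fun y hy hyS => ?_)
    have hy2 : y ∈ ball z (r / 2) := by
      rw [mem_ball] at hy ⊢
      calc dist y z ≤ dist y p' + dist p' z := dist_triangle _ _ _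
        _ < r / 8 + (r / 8 + (3 * r / 16 + 2 * δ)) := by linarith
        _ ≤ r / 2 := by linarith
    have : y ∈ S ∩ ball z (r / 2) := ⟨hyS, hy2⟩
    rw [hk] at this
    have hyl := (mem_halfPlane_iff_level k z y).1 this.1
    rw [level_split (innerNormal k) y z p'] at hyl
    have h1 := abs_level_le_dist k p' y
    have h2 := le_abs_self ((y - p') * conj (innerNormal k)).re
    rw [mem_ball] at hy
    linarith

end Exits

/-- **Choice of the number of walk periods** (registered form, sub-goal of `stub_innerPolygonsOfZigzag`). [folklore] -/
theorem zd_exists_walk_scale : ∀ (L δ : ℝ), 0 ≤ L → 0 < δ → ∃ q : ℕ, L ≤ q * Real.sqrt 3 * δ ∧ q * Real.sqrt 3 * δ ≤ L + 2 * δ :=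
  fun _ _ hL hδ => exists_walk_scale hL hδ

end Summit.CriticalPhenomena.SAWScalingLimit.Theorems.PolygonParitySqueeze.ZigzagDiscretisation

end
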